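import Mathlib.Analysis.SpecialFunctions.SmoothTransition
import Mathlib.Analysis.InnerProductSpace.Calculus
import Mathlib.Analysis.Calculus.MeanValue
import Mathlib.Analysis.InnerProductSpace.PiL2
import HarnessLib

/-!
# Smooth dyadic shell cutoffs for the annulus (Whitney shells)

Analysis/FluidPDE support file for the discharge of the named fact
`Literature.Analysis.FluidPDE.tao2011_nonlinearEstimate` (Tao 2011, §10, proof of Thm. 10.1,
estimate of `Y₆`, arXiv:1108.1165 p. 32: "We apply a Whitney-type decomposition, covering `Ω` by a
boundedly overlapping collection of balls `Bᵢ = B(xᵢ, rᵢ)` with radius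
`rᵢ := (1/100) min(dist(xᵢ, ∂Ω), c^{0.1}/δ²)`"). Our variant replaces the covering by balls with a
**smooth partition of unity into dyadic shells** of the annulus `Ω = {a < |y − x₀| < b}`
(Remark 10.6), indexed by the distance to the nearer boundary sphere; the Whitney scale is then
constant on each shell and the local analysis on a shell is carried out with balls of that scale
by Tonelli arguments (`FluidPDE/TaoY6Piece`). This file contains the one-dimensional profiles and
the cutoffs, with no reference to the fluid:

* `stepFun x = smoothTransition (2x − 1)`: smooth, monotone, `0` on `x ≤ 1/2`, `1` on `x ≥ 1`;
* `shellFun σ x = stepFun (2x/σ) − stepFun (x/σ)`: values in `[0,1]`, support in `(σ/4, σ)`,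
  Lipschitz with constant `3 L_ψ / σ`, and the telescoping identity
  `Σ_{n<N} shellFun (2⁻ⁿσ) x = stepFun (2ᴺ x/σ) − stepFun (x/σ)`;
* `shellCutoff φ σ = shellFun σ ∘ φ` for a "depth coordinate" `φ : ℝ³ → ℝ` (`|y − x₀| − a` for
  the inner shells, `b − |y − x₀|` for the outer ones), and
  `coreCutoff x₀ k a b y = stepFun (k(|y−x₀| − a)) + stepFun (k(b − |y−x₀|)) − 1`;
  smoothness, values in `[0,1]` (the core cutoff under `a + 2/k < b`), supports, and the
  gradient bounds `‖D shellCutoff‖ ≤ 3L_ψ/σ`, `‖D coreCutoff‖ ≤ 2kL_ψ` (via Lipschitz constants).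

## References

* T. Tao, arXiv:1108.1165 (`Tao2011`), §10, proof of Thm. 10.1, p. 32 (Whitney decomposition)
  and Remark 10.6 (annulus).
* E. M. Stein, *Singular integrals and differentiability properties of functions* (1970),
  Ch. VI §1 (partitions of unity adapted to Whitney decompositions).
-/

noncomputable section

open Set Filter Metric Function Topology
open scoped NNReal ContDiff

namespace Literature.Analysis.FluidPDE.TaoY6

/-! ### The smooth step `ψ` -/

/-- The smooth monotone step `ψ(x) = smoothTransition (2x − 1)`: `0` for `x ≤ 1/2`, `1` for
`x ≥ 1`. [folklore] -/
def stepFun (x : ℝ) : ℝ := Real.smoothTransition (2 * x - 1)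

/-- Unfolding `stepFun`. [folklore] -/
theorem stepFun_def (x : ℝ) : stepFun x = Real.smoothTransition (2 * x - 1) := rfl

/-- `ψ` is smooth. [folklore] -/
theorem contDiff_stepFun {n : ℕ∞} : ContDiff ℝ n stepFun :=
  Real.smoothTransition.contDiff.comp ((contDiff_const.mul contDiff_id).sub contDiff_const)

/-- `ψ` is monotone. [folklore] -/
theorem monotone_stepFun : Monotone stepFun := fun _ _ h =>
  Real.smoothTransition.monotone (by linarith)

/-- `0 ≤ ψ`. [folklore] -/
theorem stepFun_nonneg (x : ℝ) : 0 ≤ stepFun x := Real.smoothTransition.nonneg _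

/-- `ψ ≤ 1`. [folklore] -/
theorem stepFun_le_one (x : ℝ) : stepFun x ≤ 1 := Real.smoothTransition.le_one _

/-- `ψ(x) = 0` for `x ≤ 1/2`. [folklore] -/
theorem stepFun_eq_zero {x : ℝ} (hx : x ≤ 1 / 2) : stepFun x = 0 :=
  Real.smoothTransition.zero_of_nonpos (by linarith)

/-- `ψ(x) = 1` for `1 ≤ x`. [folklore] -/
theorem stepFun_eq_one {x : ℝ} (hx : 1 ≤ x) : stepFun x = 1 :=
  Real.smoothTransition.one_of_one_le (by linarith)

/-- `ψ` is locally constant (`= 0`) to the left of `1/2`. [folklore] -/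
theorem stepFun_eventuallyEq_zero {x : ℝ} (hx : x < 1 / 2) : stepFun =ᶠ[𝓝 x] fun _ => 0 := by
  filter_upwards [Iio_mem_nhds hx] with y hy using stepFun_eq_zero (le_of_lt hy)

/-- `ψ` is locally constant (`= 1`) to the right of `1`. [folklore] -/
theorem stepFun_eventuallyEq_one {x : ℝ} (hx : 1 < x) : stepFun =ᶠ[𝓝 x] fun _ => 1 := by
  filter_upwards [Ioi_mem_nhds hx] with y hy using stepFun_eq_one (le_of_lt hy)

/-- The derivative of `ψ` vanishes off `[1/2, 1]`. [folklore] -/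
theorem deriv_stepFun_eq_zero {x : ℝ} (hx : x ∉ Icc (1 / 2 : ℝ) 1) : deriv stepFun x = 0 := by
  rw [mem_Icc, not_and_or, not_le, not_le] at hx
  rcases hx with hx | hx
  · rw [(stepFun_eventuallyEq_zero hx).deriv_eq, deriv_const]
  · rw [(stepFun_eventuallyEq_one hx).deriv_eq, deriv_const]

/-- **A Lipschitz constant for `ψ`**: `L_ψ`, the maximum of `|ψ'|` (attained on `[1/2, 1]`). [folklore] -/
def stepLip : ℝ≥0 := ⟨sSup ((fun x => |deriv stepFun x|) '' Icc (1 / 2 : ℝ) 1),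
  Real.sSup_nonneg' ⟨|deriv stepFun 1|, ⟨1, ⟨by norm_num, le_rfl⟩, rfl⟩, abs_nonneg _⟩⟩

/-- `|ψ'(x)| ≤ L_ψ` everywhere. [folklore] -/
theorem abs_deriv_stepFun_le (x : ℝ) : |deriv stepFun x| ≤ (stepLip : ℝ) := by
  have hcont : Continuous fun x => |deriv stepFun x| :=
    ((contDiff_stepFun (n := 1)).continuous_deriv le_rfl).abs
  have hbdd : BddAbove ((fun x => |deriv stepFun x|) '' Icc (1 / 2 : ℝ) 1) :=
    (isCompact_Icc.image hcont).bddAbove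
  by_cases hx : x ∈ Icc (1 / 2 : ℝ) 1
  · exact le_csSup hbdd ⟨x, hx, rfl⟩
  · rw [deriv_stepFun_eq_zero hx, abs_zero]
    exact stepLip.2

/-- `ψ` is `L_ψ`-Lipschitz. [folklore] -/
theorem lipschitzWith_stepFun : LipschitzWith stepLip stepFun :=
  lipschitzWith_of_nnnorm_deriv_le ((contDiff_stepFun (n := 1)).differentiable (by simp))
    fun x => by
      rw [← NNReal.coe_le_coe, coe_nnnorm, Real.norm_eq_abs]
      exact abs_deriv_stepFun_le x

/-- `x ↦ ψ(c x)` is `|c| L_ψ`-Lipschitz. [folklore] -/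
theorem lipschitzWith_stepFun_const_mul (c : ℝ) :
    LipschitzWith (Real.toNNReal |c| * stepLip) fun x => stepFun (c * x) := by
  have hc : LipschitzWith (Real.toNNReal |c|) fun x : ℝ => c * x :=
    LipschitzWith.of_dist_le_mul fun x y => by
      rw [Real.dist_eq, Real.dist_eq, ← mul_sub, abs_mul, Real.coe_toNNReal _ (abs_nonneg c)]
  have := lipschitzWith_stepFun.comp hc
  rwa [mul_comm] at this

/-! ### The shell profile -/

/-- The dyadic shell profile `shellFun σ x = ψ(2x/σ) − ψ(x/σ)` at scale `σ`: nonnegative,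
`≤ 1`, supported in `σ/4 < x < σ`. [folklore] -/
def shellFun (σ x : ℝ) : ℝ := stepFun (2 * x / σ) - stepFun (x / σ)

/-- Unfolding `shellFun`. [folklore] -/
theorem shellFun_def (σ x : ℝ) : shellFun σ x = stepFun (2 * x / σ) - stepFun (x / σ) := rfl

/-- `0 ≤ shellFun σ x` for `σ > 0`. [folklore] -/
theorem shellFun_nonneg {σ : ℝ} (hσ : 0 < σ) (x : ℝ) : 0 ≤ shellFun σ x := by
  rw [shellFun_def, sub_nonneg]
  rcases le_or_gt 0 x with hx | hx
  · exact monotone_stepFun (by rw [div_le_div_iff_of_pos_right hσ]; linarith)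
  · rw [stepFun_eq_zero (by rw [div_le_iff₀ hσ]; nlinarith),
      stepFun_eq_zero (by rw [div_le_iff₀ hσ]; nlinarith)]

/-- `shellFun σ x ≤ 1`. [folklore] -/
theorem shellFun_le_one (σ x : ℝ) : shellFun σ x ≤ 1 := by
  rw [shellFun_def]; linarith [stepFun_le_one (2 * x / σ), stepFun_nonneg (x / σ)]

/-- `shellFun σ x = 0` for `x ≤ σ/4` (`σ > 0`). [folklore] -/
theorem shellFun_eq_zero_of_le {σ x : ℝ} (hσ : 0 < σ) (hx : x ≤ σ / 4) : shellFun σ x = 0 := by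
  rw [shellFun_def, stepFun_eq_zero (by rw [div_le_iff₀ hσ]; linarith),
    stepFun_eq_zero (by rw [div_le_iff₀ hσ]; linarith), sub_zero]

/-- `shellFun σ x = 0` for `σ ≤ x` (`σ > 0`). [folklore] -/
theorem shellFun_eq_zero_of_ge {σ x : ℝ} (hσ : 0 < σ) (hx : σ ≤ x) : shellFun σ x = 0 := by
  rw [shellFun_def, stepFun_eq_one (by rw [le_div_iff₀ hσ]; linarith),
    stepFun_eq_one (by rw [le_div_iff₀ hσ]; linarith), sub_self]

/-- Support of the shell profile: `shellFun σ x ≠ 0 → σ/4 < x < σ`. [folklore] -/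
theorem lt_and_lt_of_shellFun_ne_zero {σ x : ℝ} (hσ : 0 < σ) (h : shellFun σ x ≠ 0) :
    σ / 4 < x ∧ x < σ :=
  ⟨not_le.1 fun hx => h (shellFun_eq_zero_of_le hσ hx), not_le.1 fun hx => h (shellFun_eq_zero_of_ge hσ hx)⟩

/-- `shellFun σ` is smooth. [folklore] -/
theorem contDiff_shellFun (σ : ℝ) {n : ℕ∞} : ContDiff ℝ n (shellFun σ) :=
  (contDiff_stepFun.comp ((contDiff_const.mul contDiff_id).div_const σ)).sub
    (contDiff_stepFun.comp (contDiff_id.div_const σ))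

/-- `shellFun σ` is `(3/σ) L_ψ`-Lipschitz for `σ > 0`. [folklore] -/
theorem lipschitzWith_shellFun {σ : ℝ} (hσ : 0 < σ) :
    LipschitzWith (Real.toNNReal (3 / σ) * stepLip) (shellFun σ) := by
  have h1 := lipschitzWith_stepFun_const_mul (2 / σ)
  have h2 := lipschitzWith_stepFun_const_mul (1 / σ)
  have h := h1.sub h2
  have heq : Real.toNNReal |2 / σ| * stepLip + Real.toNNReal |1 / σ| * stepLip =
      Real.toNNReal (3 / σ) * stepLip := by
    rw [abs_of_pos (by positivity), abs_of_pos (by positivity), ← add_mul,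
      ← Real.toNNReal_add (by positivity) (by positivity)]
    congr 2; ring
  rw [heq] at h
  have hfun : shellFun σ = fun x => stepFun (2 / σ * x) - stepFun (1 / σ * x) := by
    funext x
    rw [shellFun_def, show 2 / σ * x = 2 * x / σ by ring, show 1 / σ * x = x / σ by ring]
  rw [hfun]
  exact h

/-- **Telescoping of the dyadic shells**:
`Σ_{n<N} shellFun (σ/2ⁿ) x = ψ(2ᴺ x/σ) − ψ(x/σ)`. [folklore] -/
theorem sum_range_shellFun (σ x : ℝ) (N : ℕ) :
    ∑ n ∈ Finset.range N, shellFun (σ / 2 ^ n) x = stepFun (2 ^ N * x / σ) - stepFun (x / σ) := by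
  induction N with
  | zero => simp
  | succ N ih =>
    rw [Finset.sum_range_succ, ih, shellFun_def, pow_succ]
    have e1 : 2 * x / (σ / 2 ^ N) = 2 ^ N * 2 * x / σ := by
      rw [div_div_eq_mul_div]; ring
    have e2 : x / (σ / 2 ^ N) = 2 ^ N * x / σ := by
      rw [div_div_eq_mul_div]; ring
    rw [e1, e2]
    ring

/-- The partial sums of the shells are between `0` and `1 − ψ(x/σ) ≤ 1`, and vanish for `x ≤ 0`
and for `σ ≤ x` (`σ > 0`). [folklore] -/
theorem sum_range_shellFun_mem_Icc {σ : ℝ} (hσ : 0 < σ) (x : ℝ) (N : ℕ) :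
    ∑ n ∈ Finset.range N, shellFun (σ / 2 ^ n) x ∈ Icc (0 : ℝ) 1 :=
  ⟨Finset.sum_nonneg fun n _ => shellFun_nonneg (by positivity) x, by
    rw [sum_range_shellFun]
    linarith [stepFun_le_one (2 ^ N * x / σ), stepFun_nonneg (x / σ)]⟩

/-- For `σ ≤ x` (or `x ≤ 0`) every shell vanishes, hence so does the partial sum. [folklore] -/
theorem sum_range_shellFun_eq_zero {σ x : ℝ} (hσ : 0 < σ) (hx : x ≤ 0 ∨ σ ≤ x) (N : ℕ) :
    ∑ n ∈ Finset.range N, shellFun (σ / 2 ^ n) x = 0 := by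
  refine Finset.sum_eq_zero fun n _ => ?_
  have hσn : 0 < σ / 2 ^ n := by positivity
  rcases hx with hx | hx
  · exact shellFun_eq_zero_of_le hσn (hx.trans (by positivity))
  · refine shellFun_eq_zero_of_ge hσn (le_trans ?_ hx)
    exact div_le_self hσ.le (one_le_pow₀ (by norm_num))

/-! ### Shell cutoffs on `ℝ³` -/

/-- The **shell cutoff** `χ = shellFun σ ∘ φ` attached to a depth coordinate `φ` (for the annulus
`{a < |y − x₀| < b}`: `φ = |· − x₀| − a` near the inner sphere, `φ = b − |· − x₀|` near the
outer sphere) at scale `σ`: supported where `σ/4 < φ < σ`. [cite: Tao2011, §10, proof of Thm. 10.1 (p. 32, Whitney decomposition) + Remark 10.6] -/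
def shellCutoff (φ : EuclideanSpace ℝ (Fin 3) → ℝ) (σ : ℝ) (y : EuclideanSpace ℝ (Fin 3)) : ℝ :=
  shellFun σ (φ y)

/-- Unfolding `shellCutoff`. [folklore] -/
theorem shellCutoff_apply (φ : EuclideanSpace ℝ (Fin 3) → ℝ) (σ : ℝ) (y : EuclideanSpace ℝ (Fin 3)) :
    shellCutoff φ σ y = shellFun σ (φ y) := rfl

section Shell

variable {φ : EuclideanSpace ℝ (Fin 3) → ℝ} {σ : ℝ}

/-- `0 ≤ χ ≤ 1`. [folklore] -/
theorem shellCutoff_mem_Icc (hσ : 0 < σ) (y : EuclideanSpace ℝ (Fin 3)) :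
    shellCutoff φ σ y ∈ Icc (0 : ℝ) 1 :=
  ⟨shellFun_nonneg hσ _, shellFun_le_one _ _⟩

/-- Support: `χ(y) ≠ 0 → σ/4 < φ(y) < σ`. [folklore] -/
theorem lt_and_lt_of_shellCutoff_ne_zero (hσ : 0 < σ) {y : EuclideanSpace ℝ (Fin 3)}
    (h : shellCutoff φ σ y ≠ 0) : σ / 4 < φ y ∧ φ y < σ :=
  lt_and_lt_of_shellFun_ne_zero hσ h

/-- Closed support: on `tsupport χ`, `σ/4 ≤ φ ≤ σ` (for continuous `φ`). [folklore] -/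
theorem le_and_le_of_mem_tsupport_shellCutoff (hσ : 0 < σ) (hφ : Continuous φ)
    {y : EuclideanSpace ℝ (Fin 3)} (h : y ∈ tsupport (shellCutoff φ σ)) :
    σ / 4 ≤ φ y ∧ φ y ≤ σ := by
  have hcl : IsClosed {z : EuclideanSpace ℝ (Fin 3) | σ / 4 ≤ φ z ∧ φ z ≤ σ} :=
    (isClosed_le continuous_const hφ).inter (isClosed_le hφ continuous_const)
  have hsub : support (shellCutoff φ σ) ⊆ {z | σ / 4 ≤ φ z ∧ φ z ≤ σ} := fun z hz =>
    ⟨(lt_and_lt_of_shellCutoff_ne_zero hσ hz).1.le, (lt_and_lt_of_shellCutoff_ne_zero hσ hz).2.le⟩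
  exact closure_minimal hsub hcl h

/-- `χ` is Lipschitz with constant `(3/σ) L_ψ` when `φ` is `1`-Lipschitz. [folklore] -/
theorem lipschitzWith_shellCutoff (hσ : 0 < σ) (hφ : LipschitzWith 1 φ) :
    LipschitzWith (Real.toNNReal (3 / σ) * stepLip) (shellCutoff φ σ) := by
  have h := (lipschitzWith_shellFun hσ).comp hφ
  rwa [mul_one] at h

/-- **Gradient bound**: `‖Dχ(y)‖ ≤ 3 L_ψ / σ` when `φ` is `1`-Lipschitz. [folklore] -/
theorem norm_fderiv_shellCutoff_le (hσ : 0 < σ) (hφ : LipschitzWith 1 φ)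
    (y : EuclideanSpace ℝ (Fin 3)) :
    ‖fderiv ℝ (shellCutoff φ σ) y‖ ≤ 3 / σ * stepLip := by
  have h := norm_fderiv_le_of_lipschitz ℝ (x₀ := y) (lipschitzWith_shellCutoff hσ hφ)
  rwa [NNReal.coe_mul, Real.coe_toNNReal _ (by positivity)] at h

/-- **Smoothness**: if `φ` is smooth away from a point `x₀` and `χ` vanishes near `x₀`, then `χ` is
smooth (the depth coordinates `|y − x₀| − a`, `b − |y − x₀|` are smooth off the centre). [folklore] -/
theorem contDiff_shellCutoff {x₀ : EuclideanSpace ℝ (Fin 3)} {n : ℕ∞}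
    (hφ : ∀ y, y ≠ x₀ → ContDiffAt ℝ n φ y)
    (h0 : (shellCutoff φ σ) =ᶠ[𝓝 x₀] fun _ => 0) : ContDiff ℝ n (shellCutoff φ σ) := by
  refine contDiff_iff_contDiffAt.2 fun y => ?_
  by_cases hy : y = x₀
  · subst hy
    exact (contDiffAt_const (c := (0 : ℝ))).congr_of_eventuallyEq h0
  · exact (contDiff_shellFun σ).contDiffAt.comp y (hφ y hy)

end Shell

/-! ### The two depth coordinates of the annulus -/

section Depth

variable {x₀ : EuclideanSpace ℝ (Fin 3)} {a b : ℝ}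

/-- The inner depth coordinate `y ↦ |y − x₀| − a` is `1`-Lipschitz. [folklore] -/
theorem lipschitzWith_norm_sub_sub_const (x₀ : EuclideanSpace ℝ (Fin 3)) (a : ℝ) :
    LipschitzWith 1 fun y : EuclideanSpace ℝ (Fin 3) => ‖y - x₀‖ - a :=
  LipschitzWith.of_dist_le_mul fun y z => by
    rw [NNReal.coe_one, one_mul, Real.dist_eq, dist_eq_norm]
    have := abs_norm_sub_norm_le (y - x₀) (z - x₀)
    rw [sub_sub_sub_cancel_right] at this
    calc |‖y - x₀‖ - a - (‖z - x₀‖ - a)| = |‖y - x₀‖ - ‖z - x₀‖| := by ring_nf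
      _ ≤ ‖y - z‖ := this

/-- The outer depth coordinate `y ↦ b − |y − x₀|` is `1`-Lipschitz. [folklore] -/
theorem lipschitzWith_const_sub_norm_sub (x₀ : EuclideanSpace ℝ (Fin 3)) (b : ℝ) :
    LipschitzWith 1 fun y : EuclideanSpace ℝ (Fin 3) => b - ‖y - x₀‖ :=
  LipschitzWith.of_dist_le_mul fun y z => by
    rw [NNReal.coe_one, one_mul, Real.dist_eq, dist_eq_norm]
    have := abs_norm_sub_norm_le (z - x₀) (y - x₀)
    rw [sub_sub_sub_cancel_right] at this
    calc |b - ‖y - x₀‖ - (b - ‖z - x₀‖)| = |‖z - x₀‖ - ‖y - x₀‖| := by ring_nf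
      _ ≤ ‖z - y‖ := this
      _ = ‖y - z‖ := norm_sub_rev _ _

/-- The depth coordinates are smooth off the centre. [folklore] -/
theorem contDiffAt_norm_sub_sub_const {y : EuclideanSpace ℝ (Fin 3)} (hy : y ≠ x₀) {n : ℕ∞} :
    ContDiffAt ℝ n (fun y : EuclideanSpace ℝ (Fin 3) => ‖y - x₀‖ - a) y :=
  ((contDiffAt_norm ℝ (sub_ne_zero.2 hy)).comp y (contDiffAt_id.sub contDiffAt_const)).sub
    contDiffAt_const

/-- The depth coordinates are smooth off the centre. [folklore] -/
theorem contDiffAt_const_sub_norm_sub {y : EuclideanSpace ℝ (Fin 3)} (hy : y ≠ x₀) {n : ℕ∞} :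
    ContDiffAt ℝ n (fun y : EuclideanSpace ℝ (Fin 3) => b - ‖y - x₀‖) y :=
  contDiffAt_const.sub ((contDiffAt_norm ℝ (sub_ne_zero.2 hy)).comp y
    (contDiffAt_id.sub contDiffAt_const))

/-- The inner shell cutoffs vanish near the centre when `a > 0` (there `|y − x₀| − a < 0`).
[folklore] -/
theorem shellCutoff_inner_eventuallyEq_zero (ha : 0 < a) {σ : ℝ} (hσ : 0 < σ) :
    shellCutoff (fun y : EuclideanSpace ℝ (Fin 3) => ‖y - x₀‖ - a) σ =ᶠ[𝓝 x₀] fun _ => 0 := by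
  filter_upwards [ball_mem_nhds x₀ ha] with y hy
  rw [mem_ball, dist_eq_norm] at hy
  exact shellFun_eq_zero_of_le hσ (by linarith [hσ.le])

/-- The outer shell cutoffs vanish near the centre when `σ < b` (there `b − |y − x₀| > σ`).
[folklore] -/
theorem shellCutoff_outer_eventuallyEq_zero {σ : ℝ} (hσ : 0 < σ) (hb : σ < b) :
    shellCutoff (fun y : EuclideanSpace ℝ (Fin 3) => b - ‖y - x₀‖) σ =ᶠ[𝓝 x₀] fun _ => 0 := by
  filter_upwards [ball_mem_nhds x₀ (sub_pos.2 hb)] with y hy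
  rw [mem_ball, dist_eq_norm] at hy
  exact shellFun_eq_zero_of_ge hσ (by linarith)

/-- The inner shell cutoffs are smooth (`a > 0`). [folklore] -/
theorem contDiff_shellCutoff_inner (ha : 0 < a) {σ : ℝ} (hσ : 0 < σ) {n : ℕ∞} :
    ContDiff ℝ n (shellCutoff (fun y : EuclideanSpace ℝ (Fin 3) => ‖y - x₀‖ - a) σ) :=
  contDiff_shellCutoff (fun _ hy => contDiffAt_norm_sub_sub_const hy)
    (shellCutoff_inner_eventuallyEq_zero ha hσ)

/-- The outer shell cutoffs are smooth (`σ < b`). [folklore] -/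
theorem contDiff_shellCutoff_outer {σ : ℝ} (hσ : 0 < σ) (hb : σ < b) {n : ℕ∞} :
    ContDiff ℝ n (shellCutoff (fun y : EuclideanSpace ℝ (Fin 3) => b - ‖y - x₀‖) σ) :=
  contDiff_shellCutoff (fun _ hy => contDiffAt_const_sub_norm_sub hy)
    (shellCutoff_outer_eventuallyEq_zero hσ hb)

end Depth

/-! ### The core cutoff -/

/-- The **core cutoff** `χ_core(y) = ψ(k(|y−x₀| − a)) + ψ(k(b − |y−x₀|)) − 1` of the annulus
`{a < |y − x₀| < b}` with margin `1/k` (equal to `1` where both depths exceed `1/k`, supported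
where both exceed `1/(2k)`; together with the dyadic shells it forms a partition of unity of the
annulus). [cite: Tao2011, §10, proof of Thm. 10.1 (p. 32, Whitney decomposition) + Remark 10.6] -/
def coreCutoff (x₀ : EuclideanSpace ℝ (Fin 3)) (k a b : ℝ) (y : EuclideanSpace ℝ (Fin 3)) : ℝ :=
  stepFun (k * (‖y - x₀‖ - a)) + stepFun (k * (b - ‖y - x₀‖)) - 1

section Core

variable {x₀ : EuclideanSpace ℝ (Fin 3)} {k a b : ℝ}

/-- Unfolding `coreCutoff`. [folklore] -/
theorem coreCutoff_apply (x₀ : EuclideanSpace ℝ (Fin 3)) (k a b : ℝ) (y : EuclideanSpace ℝ (Fin 3)) :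
    coreCutoff x₀ k a b y = stepFun (k * (‖y - x₀‖ - a)) + stepFun (k * (b - ‖y - x₀‖)) - 1 := rfl

/-- Under `a + 2/k ≤ b` at least one of the two steps equals `1`, so that
`χ_core = min`-like combination lies in `[0, 1]`. [folklore] -/
theorem coreCutoff_mem_Icc (hk : 0 < k) (hab : a + 2 / k ≤ b) (y : EuclideanSpace ℝ (Fin 3)) :
    coreCutoff x₀ k a b y ∈ Icc (0 : ℝ) 1 := by
  rw [coreCutoff_apply]
  rcases le_or_gt (a + 1 / k) ‖y - x₀‖ with h | h
  · have h1 : stepFun (k * (‖y - x₀‖ - a)) = 1 := by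
      refine stepFun_eq_one ?_
      have : 1 / k ≤ ‖y - x₀‖ - a := by linarith
      rw [div_le_iff₀ hk] at this
      linarith
    rw [h1]
    constructor <;> linarith [stepFun_nonneg (k * (b - ‖y - x₀‖)), stepFun_le_one (k * (b - ‖y - x₀‖))]
  · have h1 : stepFun (k * (b - ‖y - x₀‖)) = 1 := by
      refine stepFun_eq_one ?_
      have : 1 / k ≤ b - ‖y - x₀‖ := by
        have hk2 : 1 / k + 1 / k = 2 / k := by ring
        linarith
      rw [div_le_iff₀ hk] at this
      linarith
    rw [h1]
    constructor <;> linarith [stepFun_nonneg (k * (‖y - x₀‖ - a)), stepFun_le_one (k * (‖y - x₀‖ - a))]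

/-- Support of the core cutoff: `χ_core(y) ≠ 0 → 1/(2k) < |y−x₀| − a ∧ 1/(2k) < b − |y−x₀|`
(under `a + 2/k ≤ b`). [folklore] -/
theorem lt_and_lt_of_coreCutoff_ne_zero (hk : 0 < k) (hab : a + 2 / k ≤ b)
    {y : EuclideanSpace ℝ (Fin 3)} (h : coreCutoff x₀ k a b y ≠ 0) :
    1 / (2 * k) < ‖y - x₀‖ - a ∧ 1 / (2 * k) < b - ‖y - x₀‖ := by
  rw [coreCutoff_apply] at h
  have hk2 : 1 / (2 * k) * k = 1 / 2 := by field_simp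
  constructor
  · by_contra hc
    rw [not_lt] at hc
    have h0 : stepFun (k * (‖y - x₀‖ - a)) = 0 := stepFun_eq_zero (by nlinarith)
    have h1 : stepFun (k * (b - ‖y - x₀‖)) = 1 := by
      refine stepFun_eq_one ?_
      have : 2 / k - 1 / (2 * k) ≤ b - ‖y - x₀‖ := by linarith
      have e : (2 / k - 1 / (2 * k)) * k = 3 / 2 := by field_simp; ring
      nlinarith
    exact h (by rw [h0, h1]; ring)
  · by_contra hc
    rw [not_lt] at hc
    have h0 : stepFun (k * (b - ‖y - x₀‖)) = 0 := stepFun_eq_zero (by nlinarith)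
    have h1 : stepFun (k * (‖y - x₀‖ - a)) = 1 := by
      refine stepFun_eq_one ?_
      have : 2 / k - 1 / (2 * k) ≤ ‖y - x₀‖ - a := by linarith
      have e : (2 / k - 1 / (2 * k)) * k = 3 / 2 := by field_simp; ring
      nlinarith
    exact h (by rw [h0, h1]; ring)

/-- `χ_core = 1` where both depths are at least `1/k`. [folklore] -/
theorem coreCutoff_eq_one (hk : 0 < k) {y : EuclideanSpace ℝ (Fin 3)}
    (h₁ : 1 / k ≤ ‖y - x₀‖ - a) (h₂ : 1 / k ≤ b - ‖y - x₀‖) : coreCutoff x₀ k a b y = 1 := by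
  rw [coreCutoff_apply, stepFun_eq_one (by rw [div_le_iff₀ hk] at h₁; linarith),
    stepFun_eq_one (by rw [div_le_iff₀ hk] at h₂; linarith)]
  ring

/-- `χ_core` is Lipschitz with constant `2k L_ψ`. [folklore] -/
theorem lipschitzWith_coreCutoff (hk : 0 < k) :
    LipschitzWith (Real.toNNReal (2 * k) * stepLip) (coreCutoff x₀ k a b) := by
  have h1 := (lipschitzWith_stepFun_const_mul k).comp (lipschitzWith_norm_sub_sub_const x₀ a)
  have h2 := (lipschitzWith_stepFun_const_mul k).comp (lipschitzWith_const_sub_norm_sub x₀ b)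
  rw [mul_one] at h1 h2
  have h := (h1.add h2).sub (LipschitzWith.const (α := EuclideanSpace ℝ (Fin 3)) (1 : ℝ))
  have heq : Real.toNNReal |k| * stepLip + Real.toNNReal |k| * stepLip + 0 =
      Real.toNNReal (2 * k) * stepLip := by
    rw [abs_of_pos hk, add_zero, ← add_mul, ← Real.toNNReal_add hk.le hk.le, two_mul]
  rw [heq] at h
  exact h

/-- **Gradient bound**: `‖Dχ_core(y)‖ ≤ 2 k L_ψ`. [folklore] -/
theorem norm_fderiv_coreCutoff_le (hk : 0 < k) (y : EuclideanSpace ℝ (Fin 3)) :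
    ‖fderiv ℝ (coreCutoff x₀ k a b) y‖ ≤ 2 * k * stepLip := by
  have h := norm_fderiv_le_of_lipschitz ℝ (x₀ := y) (lipschitzWith_coreCutoff (x₀ := x₀) (a := a)
    (b := b) hk)
  rwa [NNReal.coe_mul, Real.coe_toNNReal _ (by positivity)] at h

/-- `χ_core` vanishes near the centre (`0 < a`, `a + 2/k ≤ b`). [folklore] -/
theorem coreCutoff_eventuallyEq_zero (hk : 0 < k) (ha : 0 < a) (hab : a + 2 / k ≤ b) :
    coreCutoff x₀ k a b =ᶠ[𝓝 x₀] fun _ => 0 := by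
  filter_upwards [ball_mem_nhds x₀ ha] with y hy
  rw [mem_ball, dist_eq_norm] at hy
  by_contra h
  have := (lt_and_lt_of_coreCutoff_ne_zero hk hab h).1
  have : (0 : ℝ) < 1 / (2 * k) := by positivity
  linarith

/-- `χ_core` is smooth (`0 < a`, `a + 2/k ≤ b`). [folklore] -/
theorem contDiff_coreCutoff (hk : 0 < k) (ha : 0 < a) (hab : a + 2 / k ≤ b) {n : ℕ∞} :
    ContDiff ℝ n (coreCutoff x₀ k a b) := by
  refine contDiff_iff_contDiffAt.2 fun y => ?_
  by_cases hy : y = x₀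
  · subst hy
    exact (contDiffAt_const (c := (0 : ℝ))).congr_of_eventuallyEq (coreCutoff_eventuallyEq_zero hk ha hab)
  · exact ((contDiff_stepFun.contDiffAt.comp y (contDiffAt_const.mul (contDiffAt_norm_sub_sub_const hy))).add
      (contDiff_stepFun.contDiffAt.comp y (contDiffAt_const.mul (contDiffAt_const_sub_norm_sub hy)))).sub
      contDiffAt_const

end Core

end Literature.Analysis.FluidPDE.TaoY6

end
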